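import Mathlib.Analysis.InnerProductSpace.Calculus
import Mathlib.Analysis.Normed.Module.Normalize
import Literature.Topology.FourManifolds.GluckTwist
import Literature.Topology.FourManifolds.SmoothEmbeddingCriteria
import HarnessLib

/-!
# The Gluck twist of `S⁴` along the unknotted 2-sphere is `S⁴`: discharge of
`Literature.Topology.FourManifolds.isGluckTwist_sphere_unknotTwo` (Gluck 1962, §17)

Sibling proof file of `GluckTwist.lean` (D-0014: the named fact
`def isGluckTwist_sphere_unknotTwo : Prop` is discharged here as
`theorem isGluckTwist_sphere_unknotTwo_holds : isGluckTwist_sphere_unknotTwo`, sorry-free). The fact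
says that `𝕊 4` itself *is a* Gluck twist of `𝕊 4` along the unknotted 2-sphere `unknotTwo`
(`Literature.IsGluckTwist (𝓡 4) (𝕊 4) unknotTwo`), i.e. that for some tubular neighbourhood `ν` of the
equatorial `S² ⊆ S⁴` there are open smooth embeddings `jA : S⁴ ∖ S² → S⁴`, `jB : S² × ℝ² → S⁴`,
jointly surjective, identifying exactly `ν (gluckMap (x, w))` with `(x, w)` for `w ≠ 0`
(`Literature.Topology.FourManifolds.IsOpenGluing`, `Literature.Topology.FourManifolds.gluckRel`).

## The printed argument

Gluck, *The embedding of two-spheres in the four-sphere*, Trans. AMS 104 (1962), §17; Gompf–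
Stipsicz, *4-Manifolds and Kirby Calculus*, Ex. 6.2.2 (a); written out in Larson–Meier, *Fibered
ribbon disks*, J. Knot Theory Ramifications 24 (2015), Lemma 4.6: "Let `U` be the unknotted
2-sphere in `S⁴`. Performing a Gluck twist on `U` gives back `(S⁴, U)`. *Proof.* `S⁴ ∖ νU = B³ × S¹`
and `Σ_U = B³ × S¹ ∪_ρ S² × D²`; since the twist `ρ (x, θ) = (rot_θ x, θ)` clearly extends over
`B³ × S¹` (rotate the `B³` factor), `Σ_U ≅ S⁴`, the diffeomorphism being this 'untwisting' on
`B³ × S¹` and the identity on `S² × D²`."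

## Its formalisation

Write `S⁴ ⊆ ℝ⁵ = ℝ³ × ℝ²`, `p = (y, v)` (`headThree p = y`, `tailTwo p = v`, `appendFive y v = p`);
the unknotted sphere `unknotTwo` (`sphereInclusion 2 4`) is `{v = 0}`.

* *The tubular neighbourhood.* `tube (x, w) = (x, w) / ‖(x, w)‖ : S² × ℝ² → S⁴` is a smooth
  embedding onto `{y ≠ 0}` with inverse `p ↦ (y / ‖y‖, v / ‖y‖)` (`tubeHomeomorph`, an
  `OpenPartialHomeomorph` with source `univ`, `C^∞` with `C^∞` inverse, hence a smooth embedding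
  by `Literature.Topology.FourManifolds.isSmoothEmbedding_of_openPartialHomeomorph`), and `tube (x, 0) = unknotTwo x`; this is
  the tubular neighbourhood `unknotTube : TwoKnot.TubularNbhd unknotTwo`, and `jB := tube`.
* *The untwisting.* On `ℝ⁵` let `twistVec (y, v) = (R_{v/‖v‖} y, v)` and
  `untwistVec (y, v) = (R_{v/‖v‖}⁻¹ y, v)`, where `R_u` (`rotThree u`, the bilinear map
  `rotateSphereTwoAux` of `GluckTwist.lean`) is the rotation of `ℝ³` about the `x₂`-axis by the unit
  vector `u`, and `R_u⁻¹ = R_ū` (`conjTwo`). They preserve `S⁴`, are mutually inverse, and are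
  `C^∞` off `{v = 0}`; the unit vector is given the junk value `e₀` at `v = 0` (`unitTwo`) so that
  both maps are the identity on the equatorial `S²`. Restricted to the complement
  `A = S⁴ ∖ S² = {v ≠ 0}` (`mem_complement_unknotTwo_iff`), `jA := sphereUntwist` is a smooth
  embedding `A → S⁴` with range `A` (`untwistHomeomorph`, `isSmoothEmbedding_untwist`).
* *The gluing relation.* For `w ≠ 0`, `sphereTwist (tube (x, w)) = tube (gluckMap (x, w))`
  (`sphereTwist_tube`: `R_u` is linear, the unit vector of `w` is that of `w / ‖(x, w)‖`, and
  `‖R_u x‖ = ‖x‖`), whence `jA a = tube b ↔ (b.2 ≠ 0 ∧ a = tube (gluckMap b)) = gluckRel ν a b`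
  (`sphereUntwist_eq_tube_iff`). Finally `range jA ∪ range jB = {v ≠ 0} ∪ {y ≠ 0} = S⁴`.

## References

* H. Gluck, *The embedding of two-spheres in the four-sphere*, Trans. Amer. Math. Soc. 104 (1962)
  308–333, §17 [GluckTAMS1962].
* R. E. Gompf, A. I. Stipsicz, *4-Manifolds and Kirby Calculus*, GSM 20 (1999), §6.2,
  Ex. 6.2.2 (a) [GompfStipsiczGSM1999].
* K. Larson, J. Meier, *Fibered ribbon disks*, J. Knot Theory Ramifications 24 (2015) 1550066,
  Lemma 4.6 [LarsonMeier2015].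
* J. M. Lee, *Introduction to Smooth Manifolds*, 2nd ed. (2013), Prop. 5.2 (smooth embeddings with
  open image) [LeeSmoothManifolds2013].

## Design notes

* All auxiliary constructions live in the namespace `Literature.GluckUnknot`; only the general lemma
  `Literature.Topology.FourManifolds.contMDiffOn_sphere_of_coe` (an `On`-version of Mathlib's `ContMDiff.codRestrict_sphere`)
  and the discharge `Literature.Topology.FourManifolds.isGluckTwist_sphere_unknotTwo_holds` are in `Literature`.
* The `Fact (finrank ℝ ℝⁿ⁺¹ = n + 1)` instances needed by Mathlib's sphere API are registered as
  *local* instances, in both spellings `Fin 3`/`Fin (2 + 1)` and `Fin 5`/`Fin (4 + 1)` under which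
  the ambient spaces of `𝕊 2`, `𝕊 4` occur.
* No declaration in this file uses `sorry`; `#print axioms` of the discharge lists only
  `propext`, `Classical.choice`, `Quot.sound`.
-/

open scoped Manifold ContDiff Topology
open Function Set

noncomputable section

namespace Literature.Topology.FourManifolds

/-- Local notation: `𝔼 n` is the model Euclidean space `EuclideanSpace ℝ (Fin n)`. -/
local notation "𝔼 " n:arg => EuclideanSpace ℝ (Fin n)

/-- Local notation: `𝕊 n` is the unit sphere in `EuclideanSpace ℝ (Fin (n + 1))`. -/
local notation "𝕊 " n:arg => (Metric.sphere (0 : EuclideanSpace ℝ (Fin (n + 1))) 1)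

/-! ## Maps into round spheres, smooth on an open set -/

section Helpers

variable {EM HM : Type*} [NormedAddCommGroup EM] [NormedSpace ℝ EM] [TopologicalSpace HM]
  {IM : ModelWithCorners ℝ EM HM} {M : Type*} [TopologicalSpace M] [ChartedSpace HM M]
  {F : Type*} [NormedAddCommGroup F] [InnerProductSpace ℝ F]

/-- `On`-version of Mathlib's `ContMDiff.codRestrict_sphere`: a map `g` into a round sphere whose
composition with the inclusion into the ambient inner product space is `C^∞` on an *open* set `s`
is `C^∞` on `s` as a map into the sphere (apply the global statement on the open submanifold `s`
and use `contMDiffAt_subtype_iff`). [folklore] -/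
theorem contMDiffOn_sphere_of_coe [IsManifold IM ∞ M] {n : ℕ} [Fact (Module.finrank ℝ F = n + 1)]
    {s : Set M} (hs : IsOpen s) {g : M → Metric.sphere (0 : F) 1}
    (hg : ContMDiffOn IM 𝓘(ℝ, F) ∞ (fun x ↦ (g x : F)) s) : ContMDiffOn IM (𝓡 n) ∞ g s := by
  intro x hx
  let U : TopologicalSpace.Opens M := ⟨s, hs⟩
  have h1 : ContMDiff IM 𝓘(ℝ, F) ∞ (fun y : U ↦ (g y : F)) :=
    hg.comp_contMDiff contMDiff_subtype_val fun y ↦ y.2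
  have h2 : ContMDiff IM (𝓡 n) ∞ (fun y : U ↦ g y) :=
    h1.codRestrict_sphere (n := n) (fun y ↦ (g y).2)
  have h3 : ContMDiffAt IM (𝓡 n) ∞ g x :=
    (contMDiffAt_subtype_iff (U := U) (x := ⟨x, hx⟩)).1 (h2 _)
  exact h3.contMDiffWithinAt

end Helpers

namespace GluckUnknot

/-! ## Coordinates on `ℝ⁵ = ℝ³ × ℝ²` -/

/-- The first three coordinates `(p₀, p₁, p₂) ∈ ℝ³` of `p ∈ ℝ⁵`. [folklore] -/
def headThree (p : 𝔼 5) : 𝔼 3 := WithLp.toLp 2 ![p 0, p 1, p 2]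

/-- The last two coordinates `(p₃, p₄) ∈ ℝ²` of `p ∈ ℝ⁵`. [folklore] -/
def tailTwo (p : 𝔼 5) : 𝔼 2 := WithLp.toLp 2 ![p 3, p 4]

/-- Concatenation `ℝ³ × ℝ² → ℝ⁵`, `(y, v) ↦ (y₀, y₁, y₂, v₀, v₁)`. [folklore] -/
def appendFive (y : 𝔼 3) (v : 𝔼 2) : 𝔼 5 := WithLp.toLp 2 ![y 0, y 1, y 2, v 0, v 1]

/-- Coordinate `0` of `headThree`. [folklore] -/
@[simp] theorem headThree_apply_zero (p : 𝔼 5) : headThree p 0 = p 0 := rfl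

/-- Coordinate `1` of `headThree`. [folklore] -/
@[simp] theorem headThree_apply_one (p : 𝔼 5) : headThree p 1 = p 1 := rfl

/-- Coordinate `2` of `headThree`. [folklore] -/
@[simp] theorem headThree_apply_two (p : 𝔼 5) : headThree p 2 = p 2 := rfl

/-- Coordinate `0` of `tailTwo`. [folklore] -/
@[simp] theorem tailTwo_apply_zero (p : 𝔼 5) : tailTwo p 0 = p 3 := rfl

/-- Coordinate `1` of `tailTwo`. [folklore] -/
@[simp] theorem tailTwo_apply_one (p : 𝔼 5) : tailTwo p 1 = p 4 := rfl

/-- Coordinate `0` of `appendFive`. [folklore] -/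
@[simp] theorem appendFive_apply_zero (y : 𝔼 3) (v : 𝔼 2) : appendFive y v 0 = y 0 := rfl

/-- Coordinate `1` of `appendFive`. [folklore] -/
@[simp] theorem appendFive_apply_one (y : 𝔼 3) (v : 𝔼 2) : appendFive y v 1 = y 1 := rfl

/-- Coordinate `2` of `appendFive`. [folklore] -/
@[simp] theorem appendFive_apply_two (y : 𝔼 3) (v : 𝔼 2) : appendFive y v 2 = y 2 := rfl

/-- Coordinate `3` of `appendFive`. [folklore] -/
@[simp] theorem appendFive_apply_three (y : 𝔼 3) (v : 𝔼 2) : appendFive y v 3 = v 0 := rfl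

/-- Coordinate `4` of `appendFive`. [folklore] -/
@[simp] theorem appendFive_apply_four (y : 𝔼 3) (v : 𝔼 2) : appendFive y v 4 = v 1 := rfl

/-- `headThree (appendFive y v) = y`. [folklore] -/
@[simp] theorem headThree_appendFive (y : 𝔼 3) (v : 𝔼 2) : headThree (appendFive y v) = y := by
  ext i; fin_cases i <;> rfl

/-- `tailTwo (appendFive y v) = v`. [folklore] -/
@[simp] theorem tailTwo_appendFive (y : 𝔼 3) (v : 𝔼 2) : tailTwo (appendFive y v) = v := by
  ext i; fin_cases i <;> rfl

/-- `ℝ⁵ = ℝ³ × ℝ²`: a vector is the concatenation of its head and its tail. [folklore] -/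
@[simp] theorem appendFive_headThree_tailTwo (p : 𝔼 5) :
    appendFive (headThree p) (tailTwo p) = p := by
  ext i; fin_cases i <;> rfl

/-- `headThree` is linear (scalars). [folklore] -/
theorem headThree_smul (c : ℝ) (p : 𝔼 5) : headThree (c • p) = c • headThree p := by
  ext i; fin_cases i <;> simp [headThree]

/-- `tailTwo` is linear (scalars). [folklore] -/
theorem tailTwo_smul (c : ℝ) (p : 𝔼 5) : tailTwo (c • p) = c • tailTwo p := by
  ext i; fin_cases i <;> simp [tailTwo]

/-- `appendFive` is linear (scalars). [folklore] -/
theorem smul_appendFive (c : ℝ) (y : 𝔼 3) (v : 𝔼 2) :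
    c • appendFive y v = appendFive (c • y) (c • v) := by
  ext i; fin_cases i <;> simp [appendFive]

/-- Pythagoras: `‖(y, v)‖² = ‖y‖² + ‖v‖²`. [folklore] -/
theorem norm_sq_appendFive (y : 𝔼 3) (v : 𝔼 2) :
    ‖appendFive y v‖ ^ 2 = ‖y‖ ^ 2 + ‖v‖ ^ 2 := by
  simp only [EuclideanSpace.real_norm_sq_eq, Fin.sum_univ_five, Fin.sum_univ_three,
    Fin.sum_univ_two, appendFive_apply_zero, appendFive_apply_one, appendFive_apply_two,
    appendFive_apply_three, appendFive_apply_four]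
  ring

/-- Pythagoras: `‖p‖² = ‖headThree p‖² + ‖tailTwo p‖²`. [folklore] -/
theorem norm_sq_eq_headThree_tailTwo (p : 𝔼 5) :
    ‖p‖ ^ 2 = ‖headThree p‖ ^ 2 + ‖tailTwo p‖ ^ 2 := by
  rw [← norm_sq_appendFive, appendFive_headThree_tailTwo]

/-- The norm of `(y, v)` only depends on `‖y‖` (and `v`). [folklore] -/
theorem norm_appendFive_congr {y y' : 𝔼 3} (h : ‖y‖ = ‖y'‖) (v : 𝔼 2) :
    ‖appendFive y v‖ = ‖appendFive y' v‖ := by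
  have h1 : ‖appendFive y v‖ ^ 2 = ‖appendFive y' v‖ ^ 2 := by
    rw [norm_sq_appendFive, norm_sq_appendFive, h]
  nlinarith [norm_nonneg (appendFive y v), norm_nonneg (appendFive y' v)]

/-- `headThree` is `C^∞` (linear). [folklore] -/
theorem contDiff_headThree : ContDiff ℝ ∞ headThree := by
  unfold headThree
  apply PiLp.contDiff_toLp.comp
  rw [contDiff_pi]
  intro i
  fin_cases i <;> simp <;> fun_prop

/-- `tailTwo` is `C^∞` (linear). [folklore] -/
theorem contDiff_tailTwo : ContDiff ℝ ∞ tailTwo := by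
  unfold tailTwo
  apply PiLp.contDiff_toLp.comp
  rw [contDiff_pi]
  intro i
  fin_cases i <;> simp <;> fun_prop

/-- `appendFive` is jointly `C^∞` (linear). [folklore] -/
theorem contDiff_appendFive : ContDiff ℝ ∞ (fun q : 𝔼 3 × 𝔼 2 ↦ appendFive q.1 q.2) := by
  unfold appendFive
  apply PiLp.contDiff_toLp.comp
  rw [contDiff_pi]
  intro i
  fin_cases i <;> simp <;> fun_prop

/-- Padding with two zeros is the standard inclusion `ℝ³ ↪ ℝ⁵` of `LocallyFlat.lean`/`Knots.lean`
(used by `sphereInclusion 2 4`, i.e. by `unknotTwo`). [folklore] -/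
theorem appendFive_zero_eq_euclideanInclusion (y : 𝔼 3) :
    appendFive y 0 = euclideanInclusion 3 5 y := by
  ext i
  fin_cases i <;> simp [euclideanInclusion_apply]

/-! ## Smoothness of the radial projection `NormedSpace.normalize` -/

section Normalize

variable {F : Type*} [NormedAddCommGroup F] [InnerProductSpace ℝ F]

/-- Mathlib's radial projection `NormedSpace.normalize z = z / ‖z‖` (junk value `0` at `z = 0`) is
`C^∞` away from `0` on a real inner product space (the norm is `C^∞` off the origin there).
[folklore] -/
theorem contDiffAt_normalize {z : F} (hz : z ≠ 0) :
    ContDiffAt ℝ ∞ (NormedSpace.normalize : F → F) z :=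
  ((contDiffAt_norm ℝ hz).inv (norm_ne_zero_iff.2 hz)).smul contDiffAt_id

/-- `NormedSpace.normalize` is `C^∞` on `{z ≠ 0}` (real inner product space). [folklore] -/
theorem contDiffOn_normalize : ContDiffOn ℝ ∞ (NormedSpace.normalize : F → F) {z | z ≠ 0} :=
  fun _ hz ↦ (contDiffAt_normalize hz).contDiffWithinAt

end Normalize

/-! ## Local `Fact` instances for the sphere API -/

/-- `finrank ℝ ℝ³ = 2 + 1` (spelling `Fin 3`), for Mathlib's sphere API on `𝕊 2`. [folklore] -/
private theorem fact_finrank_three : Fact (Module.finrank ℝ (𝔼 3) = 2 + 1) :=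
  ⟨finrank_euclideanSpace_fin⟩

/-- `finrank ℝ ℝ⁵ = 4 + 1` (spelling `Fin 5`), for Mathlib's sphere API on `𝕊 4`. [folklore] -/
private theorem fact_finrank_five : Fact (Module.finrank ℝ (𝔼 5) = 4 + 1) :=
  ⟨finrank_euclideanSpace_fin⟩

/-- `finrank ℝ ℝ³ = 2 + 1` (spelling `Fin (2 + 1)`), for Mathlib's sphere API on `𝕊 2`.
[folklore] -/
private theorem fact_finrank_two_add_one :
    Fact (Module.finrank ℝ (EuclideanSpace ℝ (Fin (2 + 1))) = 2 + 1) :=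
  ⟨finrank_euclideanSpace_fin⟩

/-- `finrank ℝ ℝ⁵ = 4 + 1` (spelling `Fin (4 + 1)`), for Mathlib's sphere API on `𝕊 4`.
[folklore] -/
private theorem fact_finrank_four_add_one :
    Fact (Module.finrank ℝ (EuclideanSpace ℝ (Fin (4 + 1))) = 4 + 1) :=
  ⟨finrank_euclideanSpace_fin⟩

attribute [local instance] fact_finrank_three fact_finrank_five fact_finrank_two_add_one
  fact_finrank_four_add_one

/-! ## The tube around the equatorial 2-sphere -/

/-- `(x, w) ≠ 0` in `ℝ⁵` for `x ∈ S²`. [folklore] -/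
theorem appendFive_ne_zero (x : 𝕊 2) (w : 𝔼 2) : appendFive x w ≠ 0 := by
  intro h
  have h1 := norm_sq_appendFive x w
  rw [h, norm_zero, norm_eq_of_mem_sphere x] at h1
  nlinarith [sq_nonneg ‖w‖]

/-- `‖(x, w)‖ > 0` for `x ∈ S²`. [folklore] -/
theorem norm_appendFive_pos (x : 𝕊 2) (w : 𝔼 2) : 0 < ‖appendFive (x : 𝔼 3) w‖ :=
  norm_pos_iff.2 (appendFive_ne_zero x w)

/-- The tube map as a map to `ℝ⁵`: `(x, w) ↦ (x, w) / ‖(x, w)‖`. [folklore] -/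
def tubeVec (q : (𝕊 2) × 𝔼 2) : 𝔼 5 := NormedSpace.normalize (appendFive q.1 q.2)

/-- The tube map takes unit values. [folklore] -/
theorem norm_tubeVec (q : (𝕊 2) × 𝔼 2) : ‖tubeVec q‖ = 1 :=
  NormedSpace.norm_normalize (appendFive_ne_zero q.1 q.2)

/-- **The tube around the equatorial 2-sphere**: `S² × ℝ² → S⁴`, `(x, w) ↦ (x, w) / ‖(x, w)‖`, the
trivialisation of the (open) normal bundle of the unknotted `S² = S⁴ ∩ (ℝ³ × {0})`
(`S⁴ ∖ νU = B³ × S¹`, Larson–Meier 2015, proof of Lemma 4.6; Gompf–Stipsicz §6.2). [folklore] -/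
def tube (q : (𝕊 2) × 𝔼 2) : 𝕊 4 := ⟨tubeVec q, by simp [norm_tubeVec q]⟩

/-- The tube map in coordinates. [folklore] -/
@[simp] theorem coe_tube (q : (𝕊 2) × 𝔼 2) : (tube q : 𝔼 5) = tubeVec q := rfl

/-- The `ℝ³`-component of `tube (x, w)` is `x / ‖(x, w)‖`. [folklore] -/
theorem headThree_tubeVec (q : (𝕊 2) × 𝔼 2) :
    headThree (tubeVec q) = ‖appendFive (q.1 : 𝔼 3) q.2‖⁻¹ • (q.1 : 𝔼 3) := by
  rw [tubeVec, NormedSpace.normalize, headThree_smul, headThree_appendFive]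

/-- The `ℝ²`-component of `tube (x, w)` is `w / ‖(x, w)‖`. [folklore] -/
theorem tailTwo_tubeVec (q : (𝕊 2) × 𝔼 2) :
    tailTwo (tubeVec q) = ‖appendFive (q.1 : 𝔼 3) q.2‖⁻¹ • q.2 := by
  rw [tubeVec, NormedSpace.normalize, tailTwo_smul, tailTwo_appendFive]

/-- The `ℝ³`-component of a point of the tube does not vanish. [folklore] -/
theorem headThree_tubeVec_ne_zero (q : (𝕊 2) × 𝔼 2) : headThree (tubeVec q) ≠ 0 := by
  rw [headThree_tubeVec]
  exact smul_ne_zero (inv_ne_zero (norm_appendFive_pos q.1 q.2).ne')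
    (ne_zero_of_mem_unit_sphere q.1)

/-- `‖headThree (tube (x, w))‖ = 1 / ‖(x, w)‖`. [folklore] -/
theorem norm_headThree_tubeVec (q : (𝕊 2) × 𝔼 2) :
    ‖headThree (tubeVec q)‖ = ‖appendFive (q.1 : 𝔼 3) q.2‖⁻¹ := by
  rw [headThree_tubeVec, norm_smul, norm_inv, norm_norm, norm_eq_of_mem_sphere q.1, mul_one]

/-- The `ℝ²`-component of `tube (x, w)` vanishes iff `w = 0`. [folklore] -/
theorem tailTwo_tubeVec_ne_zero_iff (q : (𝕊 2) × 𝔼 2) : tailTwo (tubeVec q) ≠ 0 ↔ q.2 ≠ 0 := by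
  rw [tailTwo_tubeVec, smul_ne_zero_iff]
  exact ⟨fun h ↦ h.2, fun h ↦ ⟨inv_ne_zero (norm_appendFive_pos q.1 q.2).ne', h⟩⟩

/-- The radial projection `ℝ³ → S²`, `y ↦ y / ‖y‖`, with junk value `e₀` at `y = 0`. [folklore] -/
def sphereProj (y : 𝔼 3) : 𝕊 2 :=
  if h : y = 0 then ⟨EuclideanSpace.single 0 1, by simp⟩
  else ⟨NormedSpace.normalize y, by simp [NormedSpace.norm_normalize h]⟩

/-- The radial projection off the origin, in coordinates. [folklore] -/
theorem coe_sphereProj {y : 𝔼 3} (hy : y ≠ 0) :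
    (sphereProj y : 𝔼 3) = NormedSpace.normalize y := by
  simp [sphereProj, hy]

/-- The radial projection of a positive multiple of `x ∈ S²` is `x`. [folklore] -/
theorem sphereProj_smul_coe {c : ℝ} (hc : 0 < c) (x : 𝕊 2) : sphereProj (c • (x : 𝔼 3)) = x := by
  have h : c • (x : 𝔼 3) ≠ 0 := smul_ne_zero hc.ne' (ne_zero_of_mem_unit_sphere x)
  apply Subtype.ext
  rw [coe_sphereProj h, NormedSpace.normalize_smul_of_pos hc,
    NormedSpace.normalize_eq_self_of_norm_eq_one (norm_eq_of_mem_sphere x)]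

/-- The inverse of the tube map, `(y, v) ↦ (y / ‖y‖, v / ‖y‖)` (junk value where `y = 0`).
[folklore] -/
def tubeInv (p : 𝕊 4) : (𝕊 2) × 𝔼 2 :=
  (sphereProj (headThree p), ‖headThree (p : 𝔼 5)‖⁻¹ • tailTwo p)

/-- `tubeInv` is a left inverse of `tube`. [folklore] -/
theorem tubeInv_tube (q : (𝕊 2) × 𝔼 2) : tubeInv (tube q) = q := by
  obtain ⟨x, w⟩ := q
  have hc : 0 < ‖appendFive (x : 𝔼 3) w‖⁻¹ := inv_pos.2 (norm_appendFive_pos x w)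
  simp only [tubeInv, coe_tube]
  rw [norm_headThree_tubeVec, headThree_tubeVec, tailTwo_tubeVec, sphereProj_smul_coe hc,
    smul_smul, inv_mul_cancel₀ hc.ne', one_smul]

/-- `tubeInv` is a right inverse of `tube` on `{y ≠ 0}`. [folklore] -/
theorem tube_tubeInv {p : 𝕊 4} (hp : headThree (p : 𝔼 5) ≠ 0) : tube (tubeInv p) = p := by
  have hr : 0 < ‖headThree (p : 𝔼 5)‖ := norm_pos_iff.2 hp
  apply Subtype.ext
  simp only [coe_tube, tubeVec, tubeInv, coe_sphereProj hp]
  rw [show NormedSpace.normalize (headThree (p : 𝔼 5)) = ‖headThree (p : 𝔼 5)‖⁻¹ • headThree p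
      from rfl, ← smul_appendFive, appendFive_headThree_tailTwo,
    NormedSpace.normalize_smul_of_pos (inv_pos.2 hr),
    NormedSpace.normalize_eq_self_of_norm_eq_one (norm_eq_of_mem_sphere p)]

/-- The tube map is `C^∞` (`ContMDiff.codRestrict_sphere` applied to the composition of the smooth
maps `(x, w) ↦ (x, w)` and `z ↦ z / ‖z‖`, the latter on `{z ≠ 0}`). [folklore] -/
theorem contMDiff_tube : ContMDiff ((𝓡 2).prod 𝓘(ℝ, 𝔼 2)) (𝓡 4) ∞ tube := by
  have h1 : ContMDiff ((𝓡 2).prod 𝓘(ℝ, 𝔼 2)) 𝓘(ℝ, 𝔼 3) ∞ (fun q : (𝕊 2) × 𝔼 2 ↦ (q.1 : 𝔼 3)) :=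
    contMDiff_coe_sphere.comp contMDiff_fst
  have h2 : ContMDiff ((𝓡 2).prod 𝓘(ℝ, 𝔼 2)) 𝓘(ℝ, 𝔼 2) ∞ (fun q : (𝕊 2) × 𝔼 2 ↦ q.2) :=
    contMDiff_snd
  have h3 : ContMDiff ((𝓡 2).prod 𝓘(ℝ, 𝔼 2)) 𝓘(ℝ, 𝔼 5) ∞
      (fun q : (𝕊 2) × 𝔼 2 ↦ appendFive (q.1 : 𝔼 3) q.2) :=
    contDiff_appendFive.contMDiff.comp (h1.prodMk_space h2)
  have h4 : ContMDiff ((𝓡 2).prod 𝓘(ℝ, 𝔼 2)) 𝓘(ℝ, 𝔼 5) ∞ tubeVec :=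
    contDiffOn_normalize.contMDiffOn.comp_contMDiff h3 fun q ↦ appendFive_ne_zero q.1 q.2
  exact h4.codRestrict_sphere fun q ↦ (tube q).2

/-- The set `{y ≠ 0} ⊆ S⁴` (the image of the tube) is open. [folklore] -/
theorem isOpen_headThree_ne_zero : IsOpen {p : 𝕊 4 | headThree (p : 𝔼 5) ≠ 0} :=
  isOpen_ne.preimage (contDiff_headThree.continuous.comp continuous_subtype_val)

/-- The inverse of the tube map is `C^∞` on `{y ≠ 0}`. [folklore] -/
theorem contMDiffOn_tubeInv :
    ContMDiffOn (𝓡 4) ((𝓡 2).prod 𝓘(ℝ, 𝔼 2)) ∞ tubeInv {p : 𝕊 4 | headThree (p : 𝔼 5) ≠ 0} := by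
  have hH : ContMDiff (𝓡 4) 𝓘(ℝ, 𝔼 3) ∞ (fun p : 𝕊 4 ↦ headThree (p : 𝔼 5)) :=
    contDiff_headThree.contMDiff.comp contMDiff_coe_sphere
  refine ContMDiffOn.prodMk ?_ ?_
  · apply contMDiffOn_sphere_of_coe isOpen_headThree_ne_zero
    have h1 : ContMDiffOn (𝓡 4) 𝓘(ℝ, 𝔼 3) ∞
        (fun p : 𝕊 4 ↦ NormedSpace.normalize (headThree (p : 𝔼 5)))
        {p : 𝕊 4 | headThree (p : 𝔼 5) ≠ 0} :=
      contDiffOn_normalize.contMDiffOn.comp hH.contMDiffOn fun p hp ↦ hp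
    exact h1.congr fun p hp ↦ coe_sphereProj hp
  · have hG : ContDiffOn ℝ ∞ (fun z : 𝔼 5 ↦ ‖headThree z‖⁻¹ • tailTwo z) {z | headThree z ≠ 0} :=
      fun z hz ↦ (((contDiff_headThree.contDiffAt.norm ℝ hz).inv (norm_ne_zero_iff.2 hz)).smul
        contDiff_tailTwo.contDiffAt).contDiffWithinAt
    exact hG.contMDiffOn.comp contMDiff_coe_sphere.contMDiffOn fun p hp ↦ hp

/-- The tube map as an open partial homeomorphism `S² × ℝ² ⇀ S⁴` with source `univ` and target
`{y ≠ 0}`. [folklore] -/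
def tubeHomeomorph : OpenPartialHomeomorph ((𝕊 2) × 𝔼 2) (𝕊 4) where
  toFun := tube
  invFun := tubeInv
  source := univ
  target := {p : 𝕊 4 | headThree (p : 𝔼 5) ≠ 0}
  map_source' q _ := headThree_tubeVec_ne_zero q
  map_target' _ _ := mem_univ _
  left_inv' q _ := tubeInv_tube q
  right_inv' _ hp := tube_tubeInv hp
  open_source := isOpen_univ
  open_target := isOpen_headThree_ne_zero
  continuousOn_toFun := contMDiff_tube.continuous.continuousOn
  continuousOn_invFun := contMDiffOn_tubeInv.continuousOn

/-- `tubeHomeomorph` is `tube` as a function. [folklore] -/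
@[simp] theorem coe_tubeHomeomorph : ⇑tubeHomeomorph = tube := rfl

/-- The source of `tubeHomeomorph` is everything. [folklore] -/
theorem tubeHomeomorph_source : tubeHomeomorph.source = univ := rfl

/-- The target of `tubeHomeomorph` is `{y ≠ 0}`. [folklore] -/
theorem tubeHomeomorph_target :
    tubeHomeomorph.target = {p : 𝕊 4 | headThree (p : 𝔼 5) ≠ 0} := rfl

/-- **The tube map is a smooth embedding** `S² × ℝ² ↪ S⁴` (a globally defined partial
diffeomorphism between 4-manifolds, `Literature.Topology.FourManifolds.isSmoothEmbedding_of_openPartialHomeomorph`; Lee,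
*Introduction to Smooth Manifolds*, Prop. 5.2). [folklore] -/
theorem isSmoothEmbedding_tube :
    Manifold.IsSmoothEmbedding ((𝓡 2).prod 𝓘(ℝ, 𝔼 2)) (𝓡 4) ∞ tube :=
  isSmoothEmbedding_of_openPartialHomeomorph tubeHomeomorph rfl contMDiff_tube.contMDiffOn
    contMDiffOn_tubeInv (ContinuousLinearEquiv.ofFinrankEq (by simp))

/-- The image of the tube is `{y ≠ 0} = S⁴ ∖ ({0} × S¹)`. [folklore] -/
theorem range_tube : range tube = {p : 𝕊 4 | headThree (p : 𝔼 5) ≠ 0} := by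
  rw [← image_univ, ← tubeHomeomorph_source, ← coe_tubeHomeomorph,
    tubeHomeomorph.image_source_eq_target, tubeHomeomorph_target]

/-- The image of the tube is open. [folklore] -/
theorem isOpen_range_tube : IsOpen (range tube) := by
  rw [range_tube]; exact isOpen_headThree_ne_zero

/-! ## Rotations of `ℝ³` about the `x₂`-axis and the twist of `ℝ⁵` -/

/-- The rotation of `ℝ³` about the `x₂`-axis by `u = (c, s)`:
`(y₀, y₁, y₂) ↦ (c y₀ - s y₁, s y₀ + c y₁, y₂)`, the bilinear map `rotateSphereTwoAux` of
`GluckTwist.lean` whose restriction to `S¹ × S²` is `rotateSphereTwo` (Gluck 1962, §8: `rot_θ`).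
[folklore] -/
def rotThree (u : 𝔼 2) (y : 𝔼 3) : 𝔼 3 := rotateSphereTwoAux (u, y)

/-- Coordinate `0` of the rotation. [folklore] -/
@[simp] theorem rotThree_apply_zero (u : 𝔼 2) (y : 𝔼 3) :
    rotThree u y 0 = u 0 * y 0 - u 1 * y 1 := rfl

/-- Coordinate `1` of the rotation. [folklore] -/
@[simp] theorem rotThree_apply_one (u : 𝔼 2) (y : 𝔼 3) :
    rotThree u y 1 = u 1 * y 0 + u 0 * y 1 := rfl

/-- Coordinate `2` of the rotation (the axis is fixed). [folklore] -/
@[simp] theorem rotThree_apply_two (u : 𝔼 2) (y : 𝔼 3) : rotThree u y 2 = y 2 := rfl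

/-- The conjugate `(c, s) ↦ (c, -s)` (inverse rotation). [folklore] -/
def conjTwo (u : 𝔼 2) : 𝔼 2 := WithLp.toLp 2 ![u 0, -u 1]

/-- Coordinate `0` of the conjugate. [folklore] -/
@[simp] theorem conjTwo_apply_zero (u : 𝔼 2) : conjTwo u 0 = u 0 := rfl

/-- Coordinate `1` of the conjugate. [folklore] -/
@[simp] theorem conjTwo_apply_one (u : 𝔼 2) : conjTwo u 1 = -u 1 := rfl

/-- The conjugate is `C^∞` (linear). [folklore] -/
theorem contDiff_conjTwo : ContDiff ℝ ∞ conjTwo := by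
  unfold conjTwo
  apply PiLp.contDiff_toLp.comp
  rw [contDiff_pi]
  intro i
  fin_cases i <;> simp <;> fun_prop

/-- A rotation by a unit vector preserves `‖y‖²`. [folklore] -/
theorem norm_sq_rotThree {u : 𝔼 2} (hu : u 0 ^ 2 + u 1 ^ 2 = 1) (y : 𝔼 3) :
    ‖rotThree u y‖ ^ 2 = ‖y‖ ^ 2 := by
  simp only [EuclideanSpace.real_norm_sq_eq, Fin.sum_univ_three, rotThree_apply_zero,
    rotThree_apply_one, rotThree_apply_two]
  linear_combination (y 0 ^ 2 + y 1 ^ 2) * hu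

/-- A rotation by a unit vector is norm preserving. [folklore] -/
theorem norm_rotThree {u : 𝔼 2} (hu : u 0 ^ 2 + u 1 ^ 2 = 1) (y : 𝔼 3) :
    ‖rotThree u y‖ = ‖y‖ := by
  have h := norm_sq_rotThree hu y
  nlinarith [norm_nonneg (rotThree u y), norm_nonneg y]

/-- The conjugate of a unit vector is a unit vector. [folklore] -/
theorem sq_add_sq_conjTwo (u : 𝔼 2) : conjTwo u 0 ^ 2 + conjTwo u 1 ^ 2 = u 0 ^ 2 + u 1 ^ 2 := by
  simp

/-- `R_ū ∘ R_u = id` for a unit vector `u`. [folklore] -/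
theorem rotThree_conjTwo_rotThree {u : 𝔼 2} (hu : u 0 ^ 2 + u 1 ^ 2 = 1) (y : 𝔼 3) :
    rotThree (conjTwo u) (rotThree u y) = y := by
  ext i
  fin_cases i
  · simp only [Fin.zero_eta, rotThree_apply_zero, rotThree_apply_one, conjTwo_apply_zero,
      conjTwo_apply_one]
    linear_combination y 0 * hu
  · simp only [Fin.mk_one, rotThree_apply_zero, rotThree_apply_one, conjTwo_apply_zero,
      conjTwo_apply_one]
    linear_combination y 1 * hu
  · rfl

/-- `R_u ∘ R_ū = id` for a unit vector `u`. [folklore] -/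
theorem rotThree_rotThree_conjTwo {u : 𝔼 2} (hu : u 0 ^ 2 + u 1 ^ 2 = 1) (y : 𝔼 3) :
    rotThree u (rotThree (conjTwo u) y) = y := by
  ext i
  fin_cases i
  · simp only [Fin.zero_eta, rotThree_apply_zero, rotThree_apply_one, conjTwo_apply_zero,
      conjTwo_apply_one]
    linear_combination y 0 * hu
  · simp only [Fin.mk_one, rotThree_apply_zero, rotThree_apply_one, conjTwo_apply_zero,
      conjTwo_apply_one]
    linear_combination y 1 * hu
  · rfl

/-- Rotations are linear (scalars). [folklore] -/
theorem rotThree_smul (u : 𝔼 2) (c : ℝ) (y : 𝔼 3) : rotThree u (c • y) = c • rotThree u y := by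
  ext i
  fin_cases i <;> simp <;> ring

/-- The unit vector `v / ‖v‖` of `v ∈ ℝ²`, with the junk value `e₀ = (1, 0)` (rotation angle `0`) at
`v = 0`, so that the twist maps below are the identity on the equatorial 2-sphere. [folklore] -/
def unitTwo (v : 𝔼 2) : 𝔼 2 :=
  if v = 0 then EuclideanSpace.single 0 1 else NormedSpace.normalize v

/-- Off the origin, `unitTwo v = v / ‖v‖` (the coordinates of `Literature.unitVector v`). [folklore] -/
theorem unitTwo_of_ne_zero {v : 𝔼 2} (hv : v ≠ 0) : unitTwo v = ‖v‖⁻¹ • v := by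
  simp [unitTwo, hv, NormedSpace.normalize]

/-- The junk value at the origin. [folklore] -/
@[simp] theorem unitTwo_zero : unitTwo 0 = EuclideanSpace.single 0 1 := by simp [unitTwo]

/-- `unitTwo v` is a unit vector, always. [folklore] -/
theorem norm_unitTwo (v : 𝔼 2) : ‖unitTwo v‖ = 1 := by
  by_cases hv : v = 0
  · simp [hv]
  · rw [unitTwo_of_ne_zero hv, norm_smul, norm_inv, norm_norm,
      inv_mul_cancel₀ (norm_ne_zero_iff.2 hv)]

/-- A unit vector `(c, s)` of `ℝ²` satisfies `c² + s² = 1`. [folklore] -/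
theorem sq_add_sq_of_norm_eq_one {u : 𝔼 2} (hu : ‖u‖ = 1) : u 0 ^ 2 + u 1 ^ 2 = 1 := by
  have h := EuclideanSpace.real_norm_sq_eq u
  rw [hu, Fin.sum_univ_two] at h
  linarith

/-- `unitTwo v = (c, s)` with `c² + s² = 1`. [folklore] -/
theorem sq_add_sq_unitTwo (v : 𝔼 2) : unitTwo v 0 ^ 2 + unitTwo v 1 ^ 2 = 1 :=
  sq_add_sq_of_norm_eq_one (norm_unitTwo v)

/-- The unit vector is invariant under positive rescaling. [folklore] -/
theorem unitTwo_smul {c : ℝ} (hc : 0 < c) (v : 𝔼 2) : unitTwo (c • v) = unitTwo v := by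
  by_cases hv : v = 0
  · simp [hv]
  · rw [unitTwo, unitTwo, if_neg (smul_ne_zero hc.ne' hv), if_neg hv]
    exact NormedSpace.normalize_smul_of_pos hc v

/-- The unit vector is `C^∞` off the origin (it agrees with `z ↦ z / ‖z‖` near `v ≠ 0`).
[folklore] -/
theorem contDiffAt_unitTwo {v : 𝔼 2} (hv : v ≠ 0) : ContDiffAt ℝ ∞ unitTwo v := by
  refine (contDiffAt_normalize hv).congr_of_eventuallyEq ?_
  filter_upwards [isOpen_ne.mem_nhds hv] with w hw
  simp [unitTwo, hw]

/-- The twist of `ℝ⁵ = ℝ³ × ℝ²` with angle map `g`: `(y, v) ↦ (R_{g (v/‖v‖)} y, v)`; `g = id` gives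
Gluck's twist, `g = conjTwo` its inverse. [folklore] -/
def twistVecWith (g : 𝔼 2 → 𝔼 2) (z : 𝔼 5) : 𝔼 5 :=
  appendFive (rotThree (g (unitTwo (tailTwo z))) (headThree z)) (tailTwo z)

/-- A twist preserves the `ℝ²`-component. [folklore] -/
@[simp] theorem tailTwo_twistVecWith (g : 𝔼 2 → 𝔼 2) (z : 𝔼 5) :
    tailTwo (twistVecWith g z) = tailTwo z := by
  simp [twistVecWith]

/-- A twist rotates the `ℝ³`-component. [folklore] -/
@[simp] theorem headThree_twistVecWith (g : 𝔼 2 → 𝔼 2) (z : 𝔼 5) :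
    headThree (twistVecWith g z) = rotThree (g (unitTwo (tailTwo z))) (headThree z) := by
  simp [twistVecWith]

/-- A twist whose angle map preserves unit vectors is norm preserving. [folklore] -/
theorem norm_twistVecWith {g : 𝔼 2 → 𝔼 2}
    (hg : ∀ u : 𝔼 2, u 0 ^ 2 + u 1 ^ 2 = 1 → g u 0 ^ 2 + g u 1 ^ 2 = 1) (z : 𝔼 5) :
    ‖twistVecWith g z‖ = ‖z‖ := by
  have h1 : ‖twistVecWith g z‖ ^ 2 = ‖z‖ ^ 2 := by
    rw [norm_sq_eq_headThree_tailTwo, norm_sq_eq_headThree_tailTwo z, tailTwo_twistVecWith,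
      headThree_twistVecWith, norm_sq_rotThree (hg _ (sq_add_sq_unitTwo _))]
  nlinarith [norm_nonneg (twistVecWith g z), norm_nonneg z]

/-- A twist commutes with positive rescaling. [folklore] -/
theorem twistVecWith_smul (g : 𝔼 2 → 𝔼 2) {c : ℝ} (hc : 0 < c) (z : 𝔼 5) :
    twistVecWith g (c • z) = c • twistVecWith g z := by
  rw [twistVecWith, twistVecWith, tailTwo_smul, headThree_smul, unitTwo_smul hc, rotThree_smul,
    smul_appendFive]

/-- A twist with `C^∞` angle map is `C^∞` off `{v = 0}`. [folklore] -/
theorem contDiffAt_twistVecWith {g : 𝔼 2 → 𝔼 2} (hg : ContDiff ℝ ∞ g) {z : 𝔼 5}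
    (hz : tailTwo z ≠ 0) : ContDiffAt ℝ ∞ (twistVecWith g) z := by
  have h1 : ContDiffAt ℝ ∞ (fun z ↦ g (unitTwo (tailTwo z))) z :=
    hg.contDiffAt.comp z ((contDiffAt_unitTwo hz).comp z contDiff_tailTwo.contDiffAt)
  have h2 : ContDiffAt ℝ ∞ (fun z ↦ rotThree (g (unitTwo (tailTwo z))) (headThree z)) z :=
    contDiff_rotateSphereTwoAux.contDiffAt.comp z (h1.prodMk contDiff_headThree.contDiffAt)
  exact contDiff_appendFive.contDiffAt.comp z (h2.prodMk contDiff_tailTwo.contDiffAt)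

/-- A twist with `C^∞` angle map is `C^∞` on `{v ≠ 0}`. [folklore] -/
theorem contDiffOn_twistVecWith {g : 𝔼 2 → 𝔼 2} (hg : ContDiff ℝ ∞ g) :
    ContDiffOn ℝ ∞ (twistVecWith g) {z | tailTwo z ≠ 0} :=
  fun _ hz ↦ (contDiffAt_twistVecWith hg hz).contDiffWithinAt

/-- **Gluck's twist on `ℝ⁵ = ℝ³ × ℝ²`**: `(y, v) ↦ (R_{v/‖v‖} y, v)`, the map
`τ (x, θ) = (rot_θ x, θ)` of `S² × S¹` (Gluck 1962, §8) extended linearly in `x ∈ ℝ³ ⊇ S²` and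
radially in `v ∈ ℝ²` (identity on `v = 0`). [folklore] -/
def twistVec : 𝔼 5 → 𝔼 5 := twistVecWith id

/-- The inverse twist `(y, v) ↦ (R_{v/‖v‖}⁻¹ y, v)` ("untwisting along `B³ × S¹`", Larson–Meier
2015, proof of Lemma 4.6). [folklore] -/
def untwistVec : 𝔼 5 → 𝔼 5 := twistVecWith conjTwo

/-- Gluck's twist is norm preserving. [folklore] -/
theorem norm_twistVec (z : 𝔼 5) : ‖twistVec z‖ = ‖z‖ := norm_twistVecWith (fun _ h ↦ h) z

/-- The inverse twist is norm preserving. [folklore] -/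
theorem norm_untwistVec (z : 𝔼 5) : ‖untwistVec z‖ = ‖z‖ :=
  norm_twistVecWith (fun u h ↦ (sq_add_sq_conjTwo u).trans h) z

/-- Gluck's twist preserves the `ℝ²`-component. [folklore] -/
@[simp] theorem tailTwo_twistVec (z : 𝔼 5) : tailTwo (twistVec z) = tailTwo z :=
  tailTwo_twistVecWith _ z

/-- The inverse twist preserves the `ℝ²`-component. [folklore] -/
@[simp] theorem tailTwo_untwistVec (z : 𝔼 5) : tailTwo (untwistVec z) = tailTwo z :=
  tailTwo_twistVecWith _ z

/-- `untwistVec ∘ twistVec = id`. [folklore] -/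
theorem untwistVec_twistVec (z : 𝔼 5) : untwistVec (twistVec z) = z := by
  rw [untwistVec, twistVecWith, tailTwo_twistVec, twistVec, headThree_twistVecWith, id,
    rotThree_conjTwo_rotThree (sq_add_sq_unitTwo _), appendFive_headThree_tailTwo]

/-- `twistVec ∘ untwistVec = id`. [folklore] -/
theorem twistVec_untwistVec (z : 𝔼 5) : twistVec (untwistVec z) = z := by
  rw [twistVec, twistVecWith, tailTwo_untwistVec, untwistVec, headThree_twistVecWith, id,
    rotThree_rotThree_conjTwo (sq_add_sq_unitTwo _), appendFive_headThree_tailTwo]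

/-- Gluck's twist commutes with positive rescaling. [folklore] -/
theorem twistVec_smul {c : ℝ} (hc : 0 < c) (z : 𝔼 5) : twistVec (c • z) = c • twistVec z :=
  twistVecWith_smul _ hc z

/-- Gluck's twist on a concatenated vector. [folklore] -/
theorem twistVec_appendFive (y : 𝔼 3) (v : 𝔼 2) :
    twistVec (appendFive y v) = appendFive (rotThree (unitTwo v) y) v := by
  simp [twistVec, twistVecWith]

/-- Gluck's twist is `C^∞` on `{v ≠ 0}`. [folklore] -/
theorem contDiffOn_twistVec : ContDiffOn ℝ ∞ twistVec {z | tailTwo z ≠ 0} :=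
  contDiffOn_twistVecWith contDiff_id

/-- The inverse twist is `C^∞` on `{v ≠ 0}`. [folklore] -/
theorem contDiffOn_untwistVec : ContDiffOn ℝ ∞ untwistVec {z | tailTwo z ≠ 0} :=
  contDiffOn_twistVecWith contDiff_conjTwo

/-! ## The twist maps of the 4-sphere and the key identity -/

/-- **Gluck's twist of `S⁴`** (rotate the `ℝ³`-component by the angle of the `ℝ²`-component; the
identity on the equatorial 2-sphere, a junk value). [folklore] -/
def sphereTwist (p : 𝕊 4) : 𝕊 4 :=
  ⟨twistVec p, by rw [mem_sphere_zero_iff_norm, norm_twistVec, norm_eq_of_mem_sphere p]⟩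

/-- The inverse twist of `S⁴`, the "untwisting" diffeomorphism of `S⁴ ∖ S² = B³ × S¹`
(Larson–Meier 2015, proof of Lemma 4.6). [folklore] -/
def sphereUntwist (p : 𝕊 4) : 𝕊 4 :=
  ⟨untwistVec p, by rw [mem_sphere_zero_iff_norm, norm_untwistVec, norm_eq_of_mem_sphere p]⟩

/-- The twist in coordinates. [folklore] -/
@[simp] theorem coe_sphereTwist (p : 𝕊 4) : (sphereTwist p : 𝔼 5) = twistVec p := rfl

/-- The inverse twist in coordinates. [folklore] -/
@[simp] theorem coe_sphereUntwist (p : 𝕊 4) : (sphereUntwist p : 𝔼 5) = untwistVec p := rfl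

/-- `sphereUntwist ∘ sphereTwist = id`. [folklore] -/
@[simp] theorem sphereUntwist_sphereTwist (p : 𝕊 4) : sphereUntwist (sphereTwist p) = p :=
  Subtype.ext (untwistVec_twistVec _)

/-- `sphereTwist ∘ sphereUntwist = id`. [folklore] -/
@[simp] theorem sphereTwist_sphereUntwist (p : 𝕊 4) : sphereTwist (sphereUntwist p) = p :=
  Subtype.ext (twistVec_untwistVec _)

/-- The set `{v ≠ 0} ⊆ S⁴` (the complement of the equatorial 2-sphere) is open. [folklore] -/
theorem isOpen_tailTwo_ne_zero : IsOpen {p : 𝕊 4 | tailTwo (p : 𝔼 5) ≠ 0} :=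
  isOpen_ne.preimage (contDiff_tailTwo.continuous.comp continuous_subtype_val)

/-- The twist of `S⁴` is `C^∞` off the equatorial 2-sphere. [folklore] -/
theorem contMDiffOn_sphereTwist :
    ContMDiffOn (𝓡 4) (𝓡 4) ∞ sphereTwist {p : 𝕊 4 | tailTwo (p : 𝔼 5) ≠ 0} :=
  contMDiffOn_sphere_of_coe isOpen_tailTwo_ne_zero
    (contDiffOn_twistVec.contMDiffOn.comp contMDiff_coe_sphere.contMDiffOn fun _ hp ↦ hp)

/-- The inverse twist of `S⁴` is `C^∞` off the equatorial 2-sphere. [folklore] -/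
theorem contMDiffOn_sphereUntwist :
    ContMDiffOn (𝓡 4) (𝓡 4) ∞ sphereUntwist {p : 𝕊 4 | tailTwo (p : 𝔼 5) ≠ 0} :=
  contMDiffOn_sphere_of_coe isOpen_tailTwo_ne_zero
    (contDiffOn_untwistVec.contMDiffOn.comp contMDiff_coe_sphere.contMDiffOn fun _ hp ↦ hp)

/-- The rotation `rotateSphereTwo (unitVector w) x` of `GluckTwist.lean` in coordinates.
[folklore] -/
theorem coe_rotateSphereTwo_unitVector (x : 𝕊 2) {w : 𝔼 2} (hw : w ≠ 0) :
    (rotateSphereTwo (unitVector w hw) x : 𝔼 3) = rotThree (unitTwo w) x := by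
  rw [coe_rotateSphereTwo, unitTwo_of_ne_zero hw]
  rfl

/-- **Key identity**: the twist of `S⁴` carries the tube to the Gluck-twisted tube,
`sphereTwist (tube (x, w)) = tube (gluckMap (x, w))` for `w ≠ 0` (the rotation is linear, the unit
vector of `w / ‖(x, w)‖` is that of `w`, and `‖rot x‖ = ‖x‖`): "`ρ` clearly extends over `B³ × S¹`"
(Larson–Meier 2015, proof of Lemma 4.6; Gompf–Stipsicz Ex. 6.2.2 (a)). [folklore] -/
theorem sphereTwist_tube (x : 𝕊 2) {w : 𝔼 2} (hw : w ≠ 0) :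
    sphereTwist (tube (x, w)) = tube (gluckMap (x, w)) := by
  apply Subtype.ext
  rw [gluckMap_apply_of_ne_zero x hw]
  simp only [coe_sphereTwist, coe_tube, tubeVec, NormedSpace.normalize]
  rw [twistVec_smul (inv_pos.2 (norm_appendFive_pos x w)), twistVec_appendFive,
    coe_rotateSphereTwo_unitVector x hw,
    norm_appendFive_congr (norm_rotThree (sq_add_sq_unitTwo w) (x : 𝔼 3)).symm w]

/-- **The gluing relation of the Gluck twist along the unknot**: for `a ∈ S⁴` off the equatorial
2-sphere and `b = (x, w) ∈ S² × ℝ²`, `sphereUntwist a = tube b ↔ (w ≠ 0 ∧ a = tube (gluckMap b))`,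
i.e. `↔ gluckRel ν a b` for the tube `ν`. [folklore] -/
theorem sphereUntwist_eq_tube_iff {a : 𝕊 4} (ha : tailTwo (a : 𝔼 5) ≠ 0) (b : (𝕊 2) × 𝔼 2) :
    sphereUntwist a = tube b ↔ b.2 ≠ 0 ∧ a = tube (gluckMap b) := by
  obtain ⟨x, w⟩ := b
  constructor
  · intro h
    have hw : w ≠ 0 := by
      have h1 : tailTwo ((sphereUntwist a : 𝕊 4) : 𝔼 5) ≠ 0 := by simpa using ha
      rw [h, coe_tube] at h1
      exact (tailTwo_tubeVec_ne_zero_iff (x, w)).1 h1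
    refine ⟨hw, ?_⟩
    rw [← sphereTwist_tube x hw, ← h, sphereTwist_sphereUntwist]
  · rintro ⟨hw, rfl⟩
    rw [← sphereTwist_tube x hw, sphereUntwist_sphereTwist]

/-- Every point of `S⁴ ⊆ ℝ³ × ℝ²` has a non-zero `ℝ³`- or `ℝ²`-component (the two open pieces
`{y ≠ 0} ⊇ νS²` and `{v ≠ 0} = S⁴ ∖ S²` cover `S⁴`). [folklore] -/
theorem headThree_ne_zero_or_tailTwo_ne_zero (p : 𝕊 4) :
    headThree (p : 𝔼 5) ≠ 0 ∨ tailTwo (p : 𝔼 5) ≠ 0 := by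
  by_contra h
  simp only [not_or, not_ne_iff] at h
  have h1 := norm_sq_eq_headThree_tailTwo (p : 𝔼 5)
  rw [h.1, h.2, norm_zero, norm_eq_of_mem_sphere p] at h1
  norm_num at h1

/-! ## The unknotted 2-sphere: complement, tubular neighbourhood, untwisting -/

section Unknot

variable [SphereEmbedding.SmoothnessFacts]

/-- The unknotted 2-sphere in coordinates: `unknotTwo x = (x, 0)`. [folklore] -/
theorem coe_unknotTwo_apply (x : 𝕊 2) : ((unknotTwo x : 𝕊 4) : 𝔼 5) = appendFive x 0 :=
  (appendFive_zero_eq_euclideanInclusion x).symm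

/-- A point of `S⁴` lies on the unknotted 2-sphere iff its `ℝ²`-component vanishes. [folklore] -/
theorem mem_range_unknotTwo_iff (p : 𝕊 4) : p ∈ range unknotTwo ↔ tailTwo (p : 𝔼 5) = 0 := by
  constructor
  · rintro ⟨x, rfl⟩
    rw [coe_unknotTwo_apply, tailTwo_appendFive]
  · intro hp
    have h1 : ‖headThree (p : 𝔼 5)‖ = 1 := by
      have h2 := norm_sq_eq_headThree_tailTwo (p : 𝔼 5)
      rw [hp, norm_zero, norm_eq_of_mem_sphere p] at h2
      nlinarith [norm_nonneg (headThree (p : 𝔼 5))]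
    refine ⟨⟨headThree (p : 𝔼 5), by simp [h1]⟩, Subtype.ext ?_⟩
    rw [coe_unknotTwo_apply]
    change appendFive (headThree (p : 𝔼 5)) 0 = p
    rw [← hp, appendFive_headThree_tailTwo]

/-- The complement of the unknotted 2-sphere is `{v ≠ 0} = B³ × S¹` ("`S⁴ ∖ νU = B³ × S¹`",
Larson–Meier 2015, proof of Lemma 4.6). [folklore] -/
theorem mem_complement_unknotTwo_iff (p : 𝕊 4) :
    p ∈ unknotTwo.complement ↔ tailTwo (p : 𝔼 5) ≠ 0 := by
  rw [SphereEmbedding.mem_complement_iff, mem_range_unknotTwo_iff]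

/-- Points of the complement have non-zero `ℝ²`-component. [folklore] -/
theorem tailTwo_ne_zero_of_complement (a : unknotTwo.complement) :
    tailTwo ((a : 𝕊 4) : 𝔼 5) ≠ 0 :=
  (mem_complement_unknotTwo_iff _).1 a.2

/-- On the zero section the tube is the unknotted 2-sphere: `tube (x, 0) = unknotTwo x`.
[folklore] -/
theorem tube_zero (x : 𝕊 2) : tube (x, 0) = unknotTwo x := by
  apply Subtype.ext
  rw [coe_unknotTwo_apply, coe_tube, tubeVec, NormedSpace.normalize_eq_self_of_norm_eq_one]
  have h := norm_sq_appendFive (x : 𝔼 3) 0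
  rw [norm_zero, norm_eq_of_mem_sphere x] at h
  nlinarith [norm_nonneg (appendFive (x : 𝔼 3) 0)]

/-- **The tubular neighbourhood of the unknotted 2-sphere** `S² × ℝ² ↪ S⁴`,
`(x, w) ↦ (x, w) / ‖(x, w)‖` (a `TwoKnot.TubularNbhd unknotTwo`: smooth embedding with
`ν (x, 0) = unknotTwo x`). [folklore] -/
def unknotTube : TwoKnot.TubularNbhd unknotTwo where
  toFun := tube
  isSmoothEmbedding := isSmoothEmbedding_tube
  apply_zero := tube_zero

/-- The tubular neighbourhood of the unknot is the tube map. [folklore] -/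
@[simp] theorem unknotTube_toFun : (unknotTube).toFun = tube := rfl

/-- A base point of the complement of the unknotted 2-sphere: `(0, 0, 0, 1, 0)` (used as a junk
value). [folklore] -/
def complementBase : unknotTwo.complement :=
  ⟨⟨EuclideanSpace.single 3 1, by simp⟩, by
    rw [mem_complement_unknotTwo_iff]
    intro h
    have h1 := congrArg (fun v : 𝔼 2 ↦ v 0) h
    simp at h1⟩

/-- The inverse of the untwisting map of the complement: the twist, corestricted to the complement
(junk value `complementBase` on the equatorial 2-sphere). [folklore] -/
def untwistInv (p : 𝕊 4) : unknotTwo.complement :=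
  if h : tailTwo (p : 𝔼 5) = 0 then complementBase
  else ⟨sphereTwist p, by rwa [mem_complement_unknotTwo_iff, coe_sphereTwist, tailTwo_twistVec]⟩

/-- Off the equatorial 2-sphere, `untwistInv` is the twist. [folklore] -/
theorem untwistInv_of_ne_zero {p : 𝕊 4} (hp : tailTwo (p : 𝔼 5) ≠ 0) :
    (untwistInv p : 𝕊 4) = sphereTwist p := by
  simp [untwistInv, hp]

/-- The untwisting map `S⁴ ∖ S² → S⁴` is `C^∞` (restriction of `sphereUntwist` to the open
submanifold `{v ≠ 0}`). [folklore] -/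
theorem contMDiff_sphereUntwist_complement :
    ContMDiff (𝓡 4) (𝓡 4) ∞ (fun a : unknotTwo.complement ↦ sphereUntwist a) :=
  contMDiffOn_sphereUntwist.comp_contMDiff contMDiff_subtype_val tailTwo_ne_zero_of_complement

/-- `untwistInv` is `C^∞` off the equatorial 2-sphere (as a map into the open submanifold
`S⁴ ∖ S²`, `ContMDiffWithinAt.subtypeVal_comp_iff`). [folklore] -/
theorem contMDiffOn_untwistInv :
    ContMDiffOn (𝓡 4) (𝓡 4) ∞ untwistInv {p : 𝕊 4 | tailTwo (p : 𝔼 5) ≠ 0} := by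
  intro p hp
  rw [← ContMDiffWithinAt.subtypeVal_comp_iff]
  refine (contMDiffOn_sphereTwist p hp).congr (fun y hy ↦ ?_) ?_
  · exact untwistInv_of_ne_zero hy
  · exact untwistInv_of_ne_zero hp

/-- **The untwisting of the complement** `S⁴ ∖ S² = B³ × S¹` as an open partial homeomorphism
`S⁴ ∖ S² ⇀ S⁴` with source `univ` and target `S⁴ ∖ S²`, `(y, v) ↦ (R_{v/‖v‖}⁻¹ y, v)`, with
inverse the twist (Larson–Meier 2015, proof of Lemma 4.6: "we think of this diffeomorphism as
'untwisting' along `B³ × S¹`"). [folklore] -/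
def untwistHomeomorph : OpenPartialHomeomorph unknotTwo.complement (𝕊 4) where
  toFun a := sphereUntwist a
  invFun := untwistInv
  source := univ
  target := {p : 𝕊 4 | tailTwo (p : 𝔼 5) ≠ 0}
  map_source' a _ := by
    show tailTwo (untwistVec ((a : 𝕊 4) : 𝔼 5)) ≠ 0
    rw [tailTwo_untwistVec]
    exact tailTwo_ne_zero_of_complement a
  map_target' _ _ := mem_univ _
  left_inv' a _ := by
    apply Subtype.ext
    have h : tailTwo ((sphereUntwist (a : 𝕊 4) : 𝕊 4) : 𝔼 5) ≠ 0 := by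
      rw [coe_sphereUntwist, tailTwo_untwistVec]
      exact tailTwo_ne_zero_of_complement a
    rw [untwistInv_of_ne_zero h, sphereTwist_sphereUntwist]
  right_inv' p hp := by
    show sphereUntwist (untwistInv p : 𝕊 4) = p
    rw [untwistInv_of_ne_zero hp, sphereUntwist_sphereTwist]
  open_source := isOpen_univ
  open_target := isOpen_tailTwo_ne_zero
  continuousOn_toFun := contMDiff_sphereUntwist_complement.continuous.continuousOn
  continuousOn_invFun := contMDiffOn_untwistInv.continuousOn

/-- `untwistHomeomorph` is the untwisting map as a function. [folklore] -/
theorem coe_untwistHomeomorph :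
    ⇑untwistHomeomorph = fun a : unknotTwo.complement ↦ sphereUntwist a := rfl

/-- The target of `untwistHomeomorph` is the complement `{v ≠ 0}`. [folklore] -/
theorem untwistHomeomorph_target :
    untwistHomeomorph.target = {p : 𝕊 4 | tailTwo (p : 𝔼 5) ≠ 0} := rfl

/-- **The untwisting map `S⁴ ∖ S² → S⁴` is a smooth embedding** (a globally defined partial
diffeomorphism between 4-manifolds, `Literature.Topology.FourManifolds.isSmoothEmbedding_of_openPartialHomeomorph`; Lee,
*Introduction to Smooth Manifolds*, Prop. 5.2). [folklore] -/
theorem isSmoothEmbedding_untwist :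
    Manifold.IsSmoothEmbedding (𝓡 4) (𝓡 4) ∞ (fun a : unknotTwo.complement ↦ sphereUntwist a) :=
  isSmoothEmbedding_of_openPartialHomeomorph untwistHomeomorph rfl
    contMDiff_sphereUntwist_complement.contMDiffOn contMDiffOn_untwistInv
    (ContinuousLinearEquiv.refl ℝ _)

/-- The range of the untwisting map is the complement `{v ≠ 0}`. [folklore] -/
theorem range_untwist :
    range (fun a : unknotTwo.complement ↦ sphereUntwist a) = {p : 𝕊 4 | tailTwo (p : 𝔼 5) ≠ 0} := by
  rw [← coe_untwistHomeomorph, ← image_univ, ← untwistHomeomorph_target,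
    ← untwistHomeomorph.image_source_eq_target]
  rfl

end Unknot

end GluckUnknot

/-! ## The discharge -/

open GluckUnknot in
variable [SphereEmbedding.SmoothnessFacts] in
/-- **The Gluck twist of `S⁴` along the unknotted 2-sphere is `S⁴`** (Gluck, Trans. AMS 104
(1962), §17; Gompf–Stipsicz, *4-Manifolds and Kirby Calculus*, Ex. 6.2.2 (a); Larson–Meier,
*Fibered ribbon disks* (2015), Lemma 4.6: "Let `U` be the unknotted 2-sphere in `S⁴`. Performing a
Gluck twist on `U` gives back `(S⁴, U)`", because the twist `ρ` extends over the complement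
`S⁴ ∖ νU = B³ × S¹`). Discharges the named fact `Literature.Topology.FourManifolds.isGluckTwist_sphere_unknotTwo`
(`IsGluckTwist (𝓡 4) (𝕊 4) unknotTwo`): the tubular neighbourhood is the tube
`ν (x, w) = (x, w) / ‖(x, w)‖` (`GluckUnknot.unknotTube`), the open smooth embedding of
`S² × ℝ²` is `jB = ν` (range `{y ≠ 0}`), that of the complement `S⁴ ∖ U = {v ≠ 0}` is the untwisting
`jA (y, v) = (R_{v/‖v‖}⁻¹ y, v)` (range `{v ≠ 0}`); the two ranges cover `S⁴`, and
`jA a = jB b ↔ gluckRel ν a b` is `GluckUnknot.sphereUntwist_eq_tube_iff`.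
[cite: GluckTAMS1962, §17] [cite: GompfStipsiczGSM1999, Ex. 6.2.2(a)]
[cite: LarsonMeier2015, Lemma 4.6] -/
theorem isGluckTwist_sphere_unknotTwo_holds : isGluckTwist_sphere_unknotTwo := by
  refine ⟨unknotTube, fun a ↦ sphereUntwist a, tube, isSmoothEmbedding_untwist, ?_,
    isSmoothEmbedding_tube, isOpen_range_tube, ?_, fun a b ↦ ?_⟩
  · rw [range_untwist]
    exact isOpen_tailTwo_ne_zero
  · rw [range_untwist, range_tube, eq_univ_iff_forall]
    intro p
    rcases headThree_ne_zero_or_tailTwo_ne_zero p with h | h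
    · exact Or.inr h
    · exact Or.inl h
  · show sphereUntwist (a : 𝕊 4) = tube b ↔ b.2 ≠ 0 ∧ (a : 𝕊 4) = tube (gluckMap b)
    exact sphereUntwist_eq_tube_iff (tailTwo_ne_zero_of_complement a) b

end Literature.Topology.FourManifolds

end
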